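import Literature.Topology.FourManifolds.MMSWTwistedPictureDoublePoints
import HarnessLib

/-!
# The twisted picture: no triple points, and old double points stay transverse

Sibling of `MMSWTwistedPictureDoublePoints.lean`, third step of "the twisted pictures
`D(0⃗)(stripTwistAt_k ∘ K)` are in general position" towards the named fact
`Literature.Topology.FourManifolds.MMSW.eventually_approxHasRasmussen` (Manolescu–Marengon–
Sarkar–Willis, arXiv:1910.08195, Thm. 1.4 / Prop. 8.2 (i); §8.1 in the tree's picture).
Two of the four axioms of `Knot.InGeneralPosition` for the twisted picture hold for EVERY `k`
once the bands are generic (crossing values off the closed windows) and the original picture is in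
general position:

* `twisted_no_triple` — **no triple points**: at a radius outside the windows a triple point
  would be an old one; inside a window every identified pair is (upper, lower)
  (`twisted_doublePoint_dichotomy`), and three points cannot be pairwise of opposite sides;
* `planeCurve_twisted_eventuallyEq` — off the closed windows the twisted and the original plane
  curves agree NEAR the parameter, hence have the same velocity there
  (`deriv_planeCurve_twisted_eq`);
* `twisted_transverse_old` — **old double points stay transverse**.

The remaining axiom — transversality of the NEW double points — needs `k` large
(`SmoothTransitionFlatEnds.smoothTransition_fastPhase`) and is the next file.  Everything is
proved; no definitions, no named facts.

## References

* C. Manolescu, M. Marengon, S. Sarkar, M. Willis, Duke Math. J. 172 (2023), arXiv:1910.08195,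
  §8.1. [ManolescuMarengonSarkarWillis2023]
-/

open scoped Manifold ContDiff Topology ComplexConjugate
open Function Set Filter Complex

noncomputable section

namespace Literature.Topology.FourManifolds

/-- Local notation: `𝔼 n` is the model Euclidean space `EuclideanSpace ℝ (Fin n)`. -/
local notation "𝔼 " n:arg => EuclideanSpace ℝ (Fin n)

/-- Local notation: `𝕊 n` is the unit sphere in `EuclideanSpace ℝ (Fin (n + 1))`. -/
local notation "𝕊 " n:arg => (Metric.sphere (0 : EuclideanSpace ℝ (Fin (n + 1))) 1)

namespace MMSW

open Literature.AlgebraicTopology.Homotopy.HopfFibration (zC wC ofZW zC_ofZW wC_ofZW ofZW_zC_wC)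

variable {r : ℕ}

/-! ## Off the closed windows the two pictures agree locally -/

/-- `Re z` along a model knot is continuous in the angle. [folklore] -/
theorem continuous_re_zC_comp {K : 𝕊 1 → 𝔼 4} (hK : IsModelKnot r K) :
    Continuous fun θ : ℝ ↦ (zC (K (circlePoint θ))).re := by
  have h1 : Continuous fun θ : ℝ ↦ K (circlePoint θ) :=
    (contMDiff_iff_contDiff.1 (hK.1.comp contMDiff_circlePoint)).continuous
  exact Complex.continuous_re.comp ((contDiff_zC (n := ∞)).continuous.comp h1)

/-- **Off the closed windows the twisted plane curve agrees with the original one near the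
parameter.** [folklore] -/
theorem planeCurve_twisted_eventuallyEq {K : 𝕊 1 → 𝔼 4} (hK : IsModelKnot r K) {K₃ K₃k : Knot}
    (hK₃ : ⇑K₃ = finiteApprox r 0 K) {k : ℤ} {w : ℝ} (hw : 0 < w) {e : Fin r → ℝ}
    (hK₃k : ⇑K₃k = finiteApprox r 0 (stripTwistAt r k w e ∘ K)) {s : ℝ}
    (hs : ∀ j : Fin r, (zC (K (circlePoint s))).re ∉
      Icc ((holeCentre r j).re + e j - w) ((holeCentre r j).re + e j + w)) :
    K₃k.planeCurve =ᶠ[𝓝 s] K₃.planeCurve := by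
  have hfc := continuous_re_zC_comp hK
  have hev : ∀ᶠ t in 𝓝 s, ∀ j : Fin r, (zC (K (circlePoint t))).re ∉
      Ioo ((holeCentre r j).re + e j - w) ((holeCentre r j).re + e j + w) := by
    refine eventually_all.2 fun j ↦ ?_
    have hj := hs j
    rw [mem_Icc, not_and_or, not_le, not_le] at hj
    rcases hj with hlt | hgt
    · filter_upwards [hfc.continuousAt.eventually (Iio_mem_nhds hlt)] with t ht
      have ht' : (zC (K (circlePoint t))).re < (holeCentre r j).re + e j - w := ht
      exact fun h ↦ by linarith [h.1]
    · filter_upwards [hfc.continuousAt.eventually (Ioi_mem_nhds hgt)] with t ht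
      have ht' : (holeCentre r j).re + e j + w < (zC (K (circlePoint t))).re := ht
      exact fun h ↦ by linarith [h.2]
  filter_upwards [hev] with t ht
  exact planeCurve_twisted_eq_of_notMem_windows hK₃ hw hK₃k ht

/-- Hence the velocities agree there. [folklore] -/
theorem deriv_planeCurve_twisted_eq {K : 𝕊 1 → 𝔼 4} (hK : IsModelKnot r K) {K₃ K₃k : Knot}
    (hK₃ : ⇑K₃ = finiteApprox r 0 K) {k : ℤ} {w : ℝ} (hw : 0 < w) {e : Fin r → ℝ}
    (hK₃k : ⇑K₃k = finiteApprox r 0 (stripTwistAt r k w e ∘ K)) {s : ℝ}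
    (hs : ∀ j : Fin r, (zC (K (circlePoint s))).re ∉
      Icc ((holeCentre r j).re + e j - w) ((holeCentre r j).re + e j + w)) :
    deriv K₃k.planeCurve s = deriv K₃.planeCurve s :=
  (planeCurve_twisted_eventuallyEq hK hK₃ hw hK₃k hs).deriv_eq

/-! ## Old double points stay transverse -/

/-- **Old double points of the twisted picture are transverse** (for every `k`).
[cite: ManolescuMarengonSarkarWillis2023, §8.1] -/
theorem twisted_transverse_old {K : 𝕊 1 → 𝔼 4} (hK : IsModelKnot r K) {K₃ K₃k : Knot}
    (hK₃ : ⇑K₃ = finiteApprox r 0 K) (hgp : K₃.InGeneralPosition) {k : ℤ} {w : ℝ} (hw : 0 < w)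
    {e : Fin r → ℝ} (hK₃k : ⇑K₃k = finiteApprox r 0 (stripTwistAt r k w e ∘ K)) {s t : ℝ}
    (hold : K₃.planeCurve s = K₃.planeCurve t) (hne : circlePoint s ≠ circlePoint t)
    (hs : ∀ j : Fin r, (zC (K (circlePoint s))).re ∉
      Icc ((holeCentre r j).re + e j - w) ((holeCentre r j).re + e j + w))
    (ht : ∀ j : Fin r, (zC (K (circlePoint t))).re ∉
      Icc ((holeCentre r j).re + e j - w) ((holeCentre r j).re + e j + w)) :
    cross (deriv K₃k.planeCurve s) (deriv K₃k.planeCurve t) ≠ 0 := by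
  rw [deriv_planeCurve_twisted_eq hK hK₃ hw hK₃k hs, deriv_planeCurve_twisted_eq hK hK₃ hw hK₃k ht]
  exact (hgp.transverse s t hold).resolve_left hne

/-! ## No triple points -/

/-- **The twisted picture has no triple points** (for every `k`), if the original picture is in
general position and the crossing values avoid the closed windows.
[cite: ManolescuMarengonSarkarWillis2023, §8.1] -/
theorem twisted_no_triple {K : 𝕊 1 → 𝔼 4} (hK : IsModelKnot r K) (hwK : ∀ t, wC (K t) ≠ 0)
    {K₃ K₃k : Knot} (hK₃ : ⇑K₃ = finiteApprox r 0 K) (hgp : K₃.InGeneralPosition) {k : ℤ}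
    {w : ℝ} (hw : 0 < w) {e : Fin r → ℝ} (he : ∀ j, |e j| + w < 1)
    (hK₃k : ⇑K₃k = finiteApprox r 0 (stripTwistAt r k w e ∘ K))
    (hcross : ∀ s t, K₃.planeCurve s = K₃.planeCurve t → circlePoint s ≠ circlePoint t →
      ∀ j : Fin r, (zC (K (circlePoint s))).re ∉
        Icc ((holeCentre r j).re + e j - w) ((holeCentre r j).re + e j + w))
    (s t u : ℝ) (hsu : K₃k.planeCurve s = K₃k.planeCurve u)
    (htu : K₃k.planeCurve t = K₃k.planeCurve u) :
    circlePoint s = circlePoint t ∨ circlePoint t = circlePoint u ∨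
      circlePoint s = circlePoint u := by
  by_contra hall
  push Not at hall
  obtain ⟨hst, htu', hsu'⟩ := hall
  have hts : K₃k.planeCurve s = K₃k.planeCurve t := by rw [hsu, htu]
  rcases twisted_doublePoint_dichotomy hK hwK hK₃ hw he hK₃k hcross hsu hsu' with
    ⟨hold_su, hoff_su⟩ | ⟨j, hj, hrad_su, hsign_su⟩
  · -- `(s, u)` old: then `(t, u)` is old too (radius of `u` off the windows), an old triple point
    rcases twisted_doublePoint_dichotomy hK hwK hK₃ hw he hK₃k hcross htu htu' with
      ⟨hold_tu, -⟩ | ⟨j, hj, hrad_tu, -⟩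
    · rcases hgp.no_triple s t u hold_su hold_tu with h | h | h
      · exact hst h
      · exact htu' h
      · exact hsu' h
    · rcases r.eq_zero_or_pos with hr | hr
      · subst hr; exact Fin.elim0 j
      · have h := (hoff_su j).2
        rw [hrad_tu] at h
        exact h (Ioo_subset_Icc_self hj)
  · -- `(s, u)` new in window `j`: then `(t, u)` is new as well, and `s`, `t` lie on the same side
    rcases twisted_doublePoint_dichotomy hK hwK hK₃ hw he hK₃k hcross htu htu' with
      ⟨-, hoff_tu⟩ | ⟨j', hj', hrad_tu, hsign_tu⟩
    · have h := (hoff_tu j).2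
      rw [← hrad_su] at hj
      exact h (Ioo_subset_Icc_self hj)
    · -- the pair `(s, t)`: same side, same radius in the window: impossible
      rcases twisted_doublePoint_dichotomy hK hwK hK₃ hw he hK₃k hcross hts hst with
        ⟨-, hoff_st⟩ | ⟨j'', hj'', -, hsign_st⟩
      · exact (hoff_st j).1 (Ioo_subset_Icc_self hj)
      · rcases hsign_su with ⟨hs1, hu1⟩ | ⟨hs1, hu1⟩ <;>
          rcases hsign_tu with ⟨ht1, hu2⟩ | ⟨ht1, hu2⟩ <;>
          rcases hsign_st with ⟨hs2, ht2⟩ | ⟨hs2, ht2⟩ <;> linarith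

end MMSW

end Literature.Topology.FourManifolds

end
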